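import Literature.AlgebraicGeometry.Smoothening.WeakNeronModelSmooth
import Literature.AlgebraicGeometry.Motives.ZariskiChowCover
import HarnessLib

/-!
# The weak Néron model as `R`-schemes: the charts over `Spec R`, their generic fibres in `E`,
# and the points

Topic: `Literature/AlgebraicGeometry/Smoothening` (Bosch–Lütkebohmert–Raynaud, *Néron Models*,
§3.5; M. Artin, *Néron Models*, Lemma (3.6)). Scheme-level packaging of the affine-forest form of
the weak Néron model (`WeakNeronModel`, `WeakNeronModelSmooth`) for the construction of the Néron
model (BLR Ch. 4–5): for a path `p` of the affine forest over the `s`-th chart of a projective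
model `M` of `E`,

* `ProjectiveModel.pathOver` — the chart `Spec A' → Spec R` as an object over `Spec R`;
  `smooth_pathOver` — it is smooth when `A'` is (`SmoothCharts.smooth`);
* `ProjectiveModel.isOpenImmersion_gen` — `E → P` (the generic fibre of the model) is an open
  immersion; `ProjectiveModel.pathGenToE` — the generic fibre `Spec A'[1/ϖ] → E` of the chart, an
  open immersion (`isOpenImmersion_pathGenToE`) compatible with the chart maps (`pathGenToE_gen`);
* `ProjectiveModel.exists_pathOver_point` — **the weak Néron property with values in the
  charts as schemes**: every test point `x : Spec L → E` (`L = Frac S`, `S` a discrete valuation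
  ring over `R` with uniformizer `ϖ`) is, for some smooth chart, the generic fibre of an
  `S`-valued point `x' : Spec S → Spec A'` over `R`: `Spec L → Spec S → Spec A'` factors as
  `Spec L → Spec A'[1/ϖ] → Spec A'` with `Spec L → Spec A'[1/ϖ] → E` equal to `x`.

[folklore]; no named facts (D-0026).

## References

* S. Bosch, W. Lütkebohmert, M. Raynaud, *Néron Models*, Springer 1990, §3.5.
  [BLRNeronModels1990] (Not held; numbers only.)
* M. Artin, *Néron Models*, in Cornell–Silverman (eds.), *Arithmetic Geometry*, Springer 1986,
  Lemma (3.6) (p. 225). [Artin1986NeronModels]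
-/

noncomputable section

open CategoryTheory AlgebraicGeometry IsLocalRing MvPolynomial
open scoped TensorProduct
open Literature.AlgebraicGeometry.Motives

namespace Literature.AlgebraicGeometry.Smoothening

universe u

namespace ProjectiveModel

variable {R K : Type u} [CommRing R] [IsDomain R] [IsDiscreteValuationRing R] [Field K] [Algebra R K]
  [IsFractionRing R K] {E : SchemeOver K} (M : ProjectiveModel R K E) {ϖ : R} (hϖ : Irreducible ϖ)
  (s : Fin (M.n + 1)) {N' : ℕ} {I' : Ideal (MvPolynomial (Fin N') R)}
  (p : ForestPath R ϖ (M.chartIdeal s) I')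

/-! ### The charts over `Spec R` -/

/-- The chart `Spec A' → Spec R` reached by the path `p`, as an object over `Spec R`. [folklore] -/
abbrev pathOver : Over (Spec (.of R)) :=
  Over.mk (Spec.map (CommRingCat.ofHom (algebraMap R (forestRing M s p))))

omit [IsDomain R] [IsDiscreteValuationRing R] [IsFractionRing R K] in
/-- A smooth chart is a smooth `R`-scheme. [folklore] -/
theorem smooth_pathOver (h : Algebra.Smooth R (forestRing M s p)) : Smooth (M.pathOver s p).hom := by
  change Smooth (Spec.map _)
  rw [HasRingHomProperty.Spec_iff (P := @Smooth)]
  exact RingHom.smooth_algebraMap.mpr h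

/-! ### The generic fibre of the model and of the charts inside `E` -/

include hϖ in
/-- `E → P`, the generic fibre of the projective model, is an open immersion (base change of
`Spec K → Spec R`, an open immersion for a discrete valuation ring). [folklore] -/
theorem isOpenImmersion_gen : IsOpenImmersion M.gen := by
  haveI := ZariskiChow.isLocalizationAway_of_irreducible R K hϖ
  haveI : IsOpenImmersion (Spec.map (CommRingCat.ofHom (algebraMap R K))) :=
    IsOpenImmersion.of_isLocalization ϖ
  exact MorphismProperty.IsStableUnderBaseChange.of_isPullback M.isPullback.flip ‹_›

/-- **The generic fibre `Spec A'[1/ϖ] → E` of the chart reached by `p`.** [folklore] -/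
def pathGenToE : Spec (.of (forestGenRing M s p)) ⟶ E.left :=
  haveI := M.isLocalization_away_tensor s hϖ
  Spec.map (CommRingCat.ofHom (genToForest M s p (M.chartRing s ⊗[R] K)).toRingHom) ≫ M.genChartSpec s

/-- It is an open immersion. [folklore] -/
instance isOpenImmersion_pathGenToE : IsOpenImmersion (M.pathGenToE hϖ s p) :=
  M.isOpenImmersion_specMap_genToForest_comp hϖ s p

/-- It is compatible with the chart maps: `Spec A'[1/ϖ] → E → P` is
`Spec A'[1/ϖ] → Spec A' → Spec Aₛ → P`. [folklore] -/
theorem pathGenToE_gen : M.pathGenToE hϖ s p ≫ M.gen =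
    Spec.map (CommRingCat.ofHom (algebraMap (forestRing M s p) (forestGenRing M s p))) ≫
      Spec.map (CommRingCat.ofHom p.map.toRingHom) ≫ M.chart s := by
  rw [pathGenToE, Category.assoc, M.specMap_genToForest_comp_gen hϖ s p, ← Spec.map_comp_assoc]
  rfl

/-! ### Points -/

include hϖ in
/-- **The weak Néron property with values in the charts as schemes** (BLR 3.5; Artin (3.6)):
given smooth charts `𝒞 s` of the charts of the model, every `L`-valued point `x` of `E`
(`L = Frac S`, `S` a discrete valuation ring over `R` in which `ϖ` is a uniformizer) is the
generic fibre of an `S`-valued point `x'` over `R` of one of the charts `Spec A'_{s,j}`: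
`Spec L → Spec S → Spec A'` is `Spec L → Spec A'[1/ϖ] → Spec A'` for a point
`Spec L → Spec A'[1/ϖ]` of the generic fibre of the chart mapping to `x` in `E`.
[cite: Artin1986NeronModels, Lemma (3.6) (p. 225)] -/
theorem exists_pathOver_point [IsIntegral E.left] [Smooth E.hom]
    (𝒞 : ∀ s : Fin (M.n + 1), SmoothCharts R ϖ (M.chartIdeal s))
    {S L : Type u} [CommRing S] [IsDomain S] [IsDiscreteValuationRing S] [Field L] [Algebra S L]
    [IsFractionRing S L] [Algebra R S] [Algebra K L] [Algebra R L] [IsScalarTower R S L]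
    [IsScalarTower R K L] (hπ : Irreducible (algebraMap R S ϖ))
    (x : Spec (.of L) ⟶ E.left) (hx : x ≫ E.hom = Spec.map (CommRingCat.ofHom (algebraMap K L))) :
    ∃ (s : Fin (M.n + 1)) (j : (𝒞 s).ι) (x' : Spec (.of S) ⟶ (M.pathOver s ((𝒞 s).path j)).left)
      (xL : Spec (.of L) ⟶ Spec (.of (forestGenRing M s ((𝒞 s).path j)))),
      x' ≫ (M.pathOver s ((𝒞 s).path j)).hom = Spec.map (CommRingCat.ofHom (algebraMap R S)) ∧
      xL ≫ Spec.map (CommRingCat.ofHom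
          (algebraMap (forestRing M s ((𝒞 s).path j)) (forestGenRing M s ((𝒞 s).path j)))) =
        Spec.map (CommRingCat.ofHom (algebraMap S L)) ≫ x' ∧
      xL ≫ M.pathGenToE hϖ s ((𝒞 s).path j) = x := by
  obtain ⟨s, j, b, hb⟩ := M.exists_smoothChart_lift_of_point 𝒞 hπ x hx
  let p := (𝒞 s).path j
  let B := forestRing M s p
  -- the `S`-valued point
  let x' : Spec (.of S) ⟶ Spec (.of B) := Spec.map (CommRingCat.ofHom b.toRingHom)
  have hx' : x' ≫ Spec.map (CommRingCat.ofHom (algebraMap R B)) =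
      Spec.map (CommRingCat.ofHom (algebraMap R S)) := by
    change Spec.map _ ≫ Spec.map _ = _
    rw [← Spec.map_comp, ← CommRingCat.ofHom_comp]
    congr 2
    exact RingHom.ext fun r => b.commutes r
  -- its generic fibre: `ϖ` is invertible in `L`
  have hunit : ∀ y : Submonoid.powers (algebraMap R B ϖ), IsUnit (((algebraMap S L).comp b.toRingHom) y) := by
    rintro ⟨_, n, rfl⟩
    rw [map_pow]
    refine IsUnit.pow n ?_
    change IsUnit (algebraMap S L (b (algebraMap R B ϖ)))
    rw [AlgHom.commutes]
    exact isUnit_iff_ne_zero.mpr ((IsFractionRing.to_map_eq_zero_iff (R := S) (K := L)).not.mpr hπ.ne_zero)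
  let bL : forestGenRing M s p →+* L :=
    IsLocalization.lift (M := Submonoid.powers (algebraMap R B ϖ)) (S := forestGenRing M s p) hunit
  have hbL : bL.comp (algebraMap B (forestGenRing M s p)) = (algebraMap S L).comp b.toRingHom :=
    IsLocalization.lift_comp (M := Submonoid.powers (algebraMap R B ϖ)) hunit
  let xL : Spec (.of L) ⟶ Spec (.of (forestGenRing M s p)) := Spec.map (CommRingCat.ofHom bL)
  have hxL : xL ≫ Spec.map (CommRingCat.ofHom (algebraMap B (forestGenRing M s p))) =
      Spec.map (CommRingCat.ofHom (algebraMap S L)) ≫ x' := by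
    change Spec.map _ ≫ Spec.map _ = Spec.map _ ≫ Spec.map _
    rw [← Spec.map_comp, ← Spec.map_comp, ← CommRingCat.ofHom_comp, ← CommRingCat.ofHom_comp, hbL]
  have hfin : xL ≫ M.pathGenToE hϖ s p = x := by
    -- equality in `E`: compare in `P`, `E → P` being a monomorphism
    haveI := M.isOpenImmersion_gen hϖ
    have h2 : x' ≫ Spec.map (CommRingCat.ofHom p.map.toRingHom) =
        Spec.map (CommRingCat.ofHom (b.comp p.map).toRingHom) := by
      change Spec.map _ ≫ Spec.map _ = _
      rw [← Spec.map_comp]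
      rfl
    rw [← cancel_mono M.gen, Category.assoc, pathGenToE_gen, ← Category.assoc, hxL, ← hb,
      Category.assoc, ← h2, Category.assoc]
  exact ⟨s, j, x', xL, hx', hxL, hfin⟩

end ProjectiveModel

end Literature.AlgebraicGeometry.Smoothening

end
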